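import Mathlib
import Summits.KontsevichZagierPeriods.KontsevichZagierPeriods.Theorems.InverseLandauTateLiftingGenusZeroBands
import Summits.KontsevichZagierPeriods.KontsevichZagierPeriods.Theorems.InverseLandauTateLiftingZsmulRep
import Summits.KontsevichZagierPeriods.KontsevichZagierPeriods.Theorems.BetaCancellation.Negative.Torsion
import Summits.KontsevichZagierPeriods.KontsevichZagierPeriods.Theorems.BetaCancellation.Negative.PiLink
import Literature.NumberTheory.Transcendental.KZDominatedFamilyRelations
import Literature.NumberTheory.Transcendental.KZLogCalculusProofs
import Literature.NumberTheory.Transcendental.KZProduct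

/-!
# `TateLifting` (stmt-KontsevichZagierPeriods-9129), line `Sketch` — stub `stub_slTwoZCovolume`

THE COVOLUME OF THE MODULAR GROUP INSIDE THE KONTSEVICH–ZAGIER RULES (stub 68 = route EulerFormChain's
`SLTwoZCovolume`), modulo the inversion engine (stub 66) and the value `π/3` of the arcsine band
(stub 67), both taken as hypotheses: the standard fundamental domain
`F₁ = {|x| ≤ ½, x² + y² ≥ 1, y > 0}` of `SL₂(ℤ)` with the hyperbolic area form `dx dy / y²` is
`KZ.Equivalent` to the closed unit disc `D̄` with the constant integrand `1/3`.

## Proof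

* (i) INVERSION `t ↦ 1/t` of the last coordinate (hypothesis 1): `[F₁, y⁻²] ≡ [G, g]` with
  `G = {t > 0, (x, 1/t) ∈ F₁} = {|x| ≤ ½, t > 0, t²(1 − x²) ≤ 1}` and `g = 1` on `G`;
* (ii) CLOSING THE BAND: `G` is co-null (segment `t = 0`) in the closed band
  `Ḡ = {x² ≤ ¼, 0 ≤ t, t²(1 − x²) ≤ 1}` (`SLTwoZ.exists_arcsinBandRep : [Ḡ, 1]` exists, value `π/3` by
  hypothesis 2), so `[G, g] ≡ [Ḡ, 1]` (`KZ.IntegralRep.of_sub_of_restrict_mem_relations`,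
  `KZ.of_sub_of_mem_relations_of_eqOn`);
* (iii) `[D̄, 1] ≡ 3 • [D̄, 1/3]` (`tateLifting_zsmulRep`);
* (iv) the disc minus the two points `(±1, 0)` is the conic band
  `D° = {−1 < x < 1, −√(1−x²) ≤ t ≤ √(1−x²)}` (`BetaCancellationNegative.discBand`;
  `[D°, 1] = KZ.piRep.restrict D° ≡ [D̄, 1] = KZ.piRep`), and `Ḡ` is the conic band
  `{x² ≤ ¼, 0 ≤ t ≤ √(1−x²)/(1−x²)}` of the same conic `t² = 1 − x²` over `ℚ̄ ∩ ℝ`;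
* (v) `3 • [Ḡ, 1] − [D°, 1]` evaluates to `3 · π/3 − π = 0`, hence is a relation by the conic-band
  kernel `conicBandKernel` (Conjecture 1 on the genus-zero sector with conic bands);
* (vi) assemble in `KZ.FormalRep` and divide by `3` (torsion-freeness of `FormalRep ⧸ relations`,
  `BetaCancellationNegative.zsmul_mem_relations_iff`).

References: M. Kontsevich, D. Zagier, *Periods* (2001), §1.1 eq. (1), §1.2.
-/

noncomputable section

open MeasureTheory Set
open Literature.NumberTheory.Transcendental
open Literature.ModelTheory.ExponentialFields (IsSemialgebraic)
open Summit.KontsevichZagierPeriods.KontsevichZagierPeriods.BetaCancellationNegative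
  (zsmul_mem_relations_iff symIoo mem_symIoo isSemialgebraic_symIoo discBand isSemialgebraic_discBand
    discBand_subset_piDisc volume_piDisc_diff_discBand)

namespace Summit.KontsevichZagierPeriods.InverseLandau

namespace SLTwoZ

/-- The unit circle `t² = 1 − x²` is the conic `t² = a x² + b x + c` with `(a, b, c) = (−1, 0, 1)`
over `ℚ̄ ∩ ℝ`. [folklore] -/
theorem conic_eq (x : Fin 1 → ℝ) :
    ((-1 : algebraicClosure ℚ ℝ) : ℝ) * x 0 ^ 2 + ((0 : algebraicClosure ℚ ℝ) : ℝ) * x 0 +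
      ((1 : algebraicClosure ℚ ℝ) : ℝ) = 1 - x 0 ^ 2 := by
  push_cast; ring

/-! ### The unit disc as a conic band: `[D°, 1] = KZ.piRep.restrict discBand ⋯` -/

/-- `[D̄, 1] − [D°, 1]` is a relation: `D̄ ∖ D° = {(±1, 0)}` is null (rule (1)).
[cite: KontsevichZagier2001, §1.2 rule (1)] -/
theorem piRep_sub_discBandRep :
    KZ.of KZ.piRep - KZ.of (KZ.piRep.restrict discBand isSemialgebraic_discBand discBand_subset_piDisc) ∈
      KZ.relations :=
  KZ.piRep.of_sub_of_restrict_mem_relations isSemialgebraic_discBand discBand_subset_piDisc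
    volume_piDisc_diff_discBand

/-- The disc band has the area `π` of the disc. [cite: KontsevichZagier2001, §1.1 eq. (1)] -/
theorem discBandRep_value :
    (KZ.piRep.restrict discBand isSemialgebraic_discBand discBand_subset_piDisc).value = Real.pi :=
  (KZ.Equivalent.value_eq_holds (r := KZ.piRep)
    (r' := KZ.piRep.restrict discBand isSemialgebraic_discBand discBand_subset_piDisc)
    piRep_sub_discBandRep).symm.trans KZ.piRep_value

/-- The conic `1 − x²` is positive on the base `(−1, 1)` of the disc band. [folklore] -/
theorem conic_pos_of_mem_symIoo (x : Fin 1 → ℝ) (hx : x ∈ symIoo) :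
    0 < ((-1 : algebraicClosure ℚ ℝ) : ℝ) * x 0 ^ 2 + ((0 : algebraicClosure ℚ ℝ) : ℝ) * x 0 +
      ((1 : algebraicClosure ℚ ℝ) : ℝ) := by
  rw [conic_eq]
  rw [mem_symIoo, mem_Ioo] at hx
  nlinarith [mul_pos (sub_pos.2 hx.2) (neg_lt_iff_pos_add.1 hx.1)]

/-! ### The arcsine band `Ḡ = {x² ≤ ¼, 0 ≤ t, t²(1 − x²) ≤ 1}` -/

/-- `Ḡ` in band shape: `{x² ≤ ¼, 0 ≤ t ≤ √(1−x²)/(1−x²)}` (`√q/q = 1/√q`). [folklore] -/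
theorem arcsinBand_eq :
    {z : Fin 2 → ℝ | z 0 ^ 2 ≤ 1 / 4 ∧ 0 ≤ z 1 ∧ z 1 ^ 2 * (1 - z 0 ^ 2) ≤ 1} =
    {z | (Fin.init z : Fin 1 → ℝ) ∈ {x : Fin 1 → ℝ | x 0 ^ 2 ≤ 1 / 4} ∧
      (fun _ : Fin 1 → ℝ => (0 : ℝ)) (Fin.init z) ≤ z (Fin.last 1) ∧
      z (Fin.last 1) ≤ (fun x : Fin 1 → ℝ => Real.sqrt (1 - x 0 ^ 2) / (1 - x 0 ^ 2)) (Fin.init z)} := by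
  ext z
  show z 0 ^ 2 ≤ 1 / 4 ∧ 0 ≤ z 1 ∧ z 1 ^ 2 * (1 - z 0 ^ 2) ≤ 1 ↔
    z 0 ^ 2 ≤ 1 / 4 ∧ 0 ≤ z 1 ∧ z 1 ≤ Real.sqrt (1 - z 0 ^ 2) / (1 - z 0 ^ 2)
  refine and_congr_right fun h0 => and_congr_right fun h1 => ?_
  have hs : 0 < 1 - z 0 ^ 2 := by linarith
  rw [Real.sqrt_div_self', le_div_iff₀ (Real.sqrt_pos.2 hs),
    ← sq_le_one_iff₀ (mul_nonneg h1 (Real.sqrt_nonneg _)), mul_pow, Real.sq_sqrt hs.le]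

/-- The base `{x² ≤ ¼}` of `Ḡ` is `ℚ`-semialgebraic. [folklore] -/
theorem isSemialgebraic_arcsinBase : IsSemialgebraic ℚ {x : Fin 1 → ℝ | x 0 ^ 2 ≤ 1 / 4} := by
  have h := Literature.ModelTheory.ExponentialFields.isSemialgebraic_setOf_eval_le (k := ℚ)
    (R := ℝ) (4 * MvPolynomial.X 0 ^ 2 : MvPolynomial (Fin 1) ℚ) 1
  have hset : {x : Fin 1 → ℝ | x 0 ^ 2 ≤ 1 / 4} = {x : Fin 1 → ℝ | MvPolynomial.aeval x
      (4 * MvPolynomial.X 0 ^ 2 : MvPolynomial (Fin 1) ℚ) ≤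
        MvPolynomial.aeval x (1 : MvPolynomial (Fin 1) ℚ)} := by
    ext x
    simp only [mem_setOf_eq, map_mul, map_pow, map_ofNat, map_one, MvPolynomial.aeval_X]
    constructor <;> intro h' <;> linarith
  rw [hset]
  exact h

/-- `Ḡ` is `ℚ`-semialgebraic (three polynomial inequalities). [folklore] -/
theorem isSemialgebraic_arcsinBand :
    IsSemialgebraic ℚ {z : Fin 2 → ℝ | z 0 ^ 2 ≤ 1 / 4 ∧ 0 ≤ z 1 ∧ z 1 ^ 2 * (1 - z 0 ^ 2) ≤ 1} := by
  have h1 := Literature.ModelTheory.ExponentialFields.isSemialgebraic_setOf_eval_le (k := ℚ) (R := ℝ)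
    (4 * MvPolynomial.X 0 ^ 2 : MvPolynomial (Fin 2) ℚ) 1
  have h2 := Literature.ModelTheory.ExponentialFields.isSemialgebraic_setOf_eval_le (k := ℚ) (R := ℝ)
    (0 : MvPolynomial (Fin 2) ℚ) (MvPolynomial.X 1)
  have h3 := Literature.ModelTheory.ExponentialFields.isSemialgebraic_setOf_eval_le (k := ℚ) (R := ℝ)
    (MvPolynomial.X 1 ^ 2 * (1 - MvPolynomial.X 0 ^ 2) : MvPolynomial (Fin 2) ℚ) 1
  have hset : {z : Fin 2 → ℝ | z 0 ^ 2 ≤ 1 / 4 ∧ 0 ≤ z 1 ∧ z 1 ^ 2 * (1 - z 0 ^ 2) ≤ 1} =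
      ({z : Fin 2 → ℝ | MvPolynomial.aeval z (4 * MvPolynomial.X 0 ^ 2 : MvPolynomial (Fin 2) ℚ) ≤
        MvPolynomial.aeval z (1 : MvPolynomial (Fin 2) ℚ)} ∩
      {z : Fin 2 → ℝ | MvPolynomial.aeval z (0 : MvPolynomial (Fin 2) ℚ) ≤
        MvPolynomial.aeval z (MvPolynomial.X 1 : MvPolynomial (Fin 2) ℚ)}) ∩
      {z : Fin 2 → ℝ | MvPolynomial.aeval z (MvPolynomial.X 1 ^ 2 * (1 - MvPolynomial.X 0 ^ 2) :
        MvPolynomial (Fin 2) ℚ) ≤ MvPolynomial.aeval z (1 : MvPolynomial (Fin 2) ℚ)} := by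
    ext z
    simp only [mem_setOf_eq, mem_inter_iff, map_pow, map_mul, map_sub, map_one, map_zero,
      map_ofNat, MvPolynomial.aeval_X]
    constructor
    · rintro ⟨h0, h1, h3⟩; exact ⟨⟨by linarith, h1⟩, h3⟩
    · rintro ⟨⟨h0, h1⟩, h3⟩; exact ⟨by linarith, h1, h3⟩
  rw [hset]
  exact (h1.inter h2).inter h3

/-- `Ḡ` is bounded: it lies in the sup-norm ball of radius `2` (`t² ≤ 4/3` on `Ḡ`). [folklore] -/
theorem arcsinBand_subset_closedBall :
    {z : Fin 2 → ℝ | z 0 ^ 2 ≤ 1 / 4 ∧ 0 ≤ z 1 ∧ z 1 ^ 2 * (1 - z 0 ^ 2) ≤ 1} ⊆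
      Metric.closedBall (0 : Fin 2 → ℝ) 2 := by
  rintro z ⟨h0, h1, h2⟩
  rw [mem_closedBall_zero_iff, pi_norm_le_iff_of_nonneg (by norm_num : (0 : ℝ) ≤ 2),
    Fin.forall_fin_two, Real.norm_eq_abs, Real.norm_eq_abs, abs_le, abs_le]
  exact ⟨⟨by nlinarith [sq_nonneg (z 0)], by nlinarith [sq_nonneg (z 0)]⟩, by linarith,
    by nlinarith [sq_nonneg (z 1), sq_nonneg (z 0)]⟩

/-- **The arcsine band representation `[Ḡ, 1]` exists** (bounded `ℚ`-semialgebraic domain,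
integrand `1`). [cite: KontsevichZagier2001, §1.1] -/
theorem exists_arcsinBandRep : ∃ g : KZ.IntegralRep 2,
    g.domain = {z | z 0 ^ 2 ≤ 1 / 4 ∧ 0 ≤ z 1 ∧ z 1 ^ 2 * (1 - z 0 ^ 2) ≤ 1} ∧
    ∀ z ∈ g.domain, g.integrand z = 1 :=
  ⟨⟨{z | z 0 ^ 2 ≤ 1 / 4 ∧ 0 ≤ z 1 ∧ z 1 ^ 2 * (1 - z 0 ^ 2) ≤ 1}, fun _ => 1,
    isSemialgebraic_arcsinBand,
    by simpa using isSemialgebraicFunOn_aeval isSemialgebraic_arcsinBand (1 : MvPolynomial (Fin 2) ℚ),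
    integrableOn_const (ne_top_of_le_ne_top measure_closedBall_lt_top.ne
      (measure_mono arcsinBand_subset_closedBall))⟩, rfl, fun _ _ => rfl⟩

/-- The conic `1 − x²` is positive (indeed `≥ ¾`) on the base `{x² ≤ ¼}` of `Ḡ`. [folklore] -/
theorem conic_pos_of_mem_arcsinBase (x : Fin 1 → ℝ) (hx : x ∈ {x : Fin 1 → ℝ | x 0 ^ 2 ≤ 1 / 4}) :
    0 < ((-1 : algebraicClosure ℚ ℝ) : ℝ) * x 0 ^ 2 + ((0 : algebraicClosure ℚ ℝ) : ℝ) * x 0 +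
      ((1 : algebraicClosure ℚ ℝ) : ℝ) := by
  rw [conic_eq]
  have hx' : x 0 ^ 2 ≤ 1 / 4 := hx
  linarith

/-! ### The conic-band kernel on `m • [Ḡ, 1] − [D°, 1]` -/

/-- **`m • [Ḡ, 1] − [D°, 1]` is a relation as soon as it evaluates to `0`**: both `[Ḡ, 1]`
(base `{x² ≤ ¼}`, arcs `0 ≤ t ≤ √(1−x²)/(1−x²)`) and `[D°, 1]` (base `(−1, 1)`, arcs `∓√(1−x²)`) are
conic-band generators of the conic `t² = 1 − x²` over `ℚ̄ ∩ ℝ`, so `conicBandKernel` (Conjecture 1 on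
the genus-zero sector with conic bands) applies. [cite: KontsevichZagier2001, §1.2] -/
theorem zsmul_sub_discBandRep_mem_relations (g : KZ.IntegralRep 2)
    (hgd : g.domain = {z | z 0 ^ 2 ≤ 1 / 4 ∧ 0 ≤ z 1 ∧ z 1 ^ 2 * (1 - z 0 ^ 2) ≤ 1})
    (hgi : ∀ z ∈ g.domain, g.integrand z = 1) (m : ℤ)
    (h0 : KZ.eval (m • KZ.of g -
      KZ.of (KZ.piRep.restrict discBand isSemialgebraic_discBand discBand_subset_piDisc)) = 0) :
    m • KZ.of g - KZ.of (KZ.piRep.restrict discBand isSemialgebraic_discBand discBand_subset_piDisc) ∈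
      KZ.relations := by
  refine conicBandKernel _ (sub_mem (AddSubgroup.zsmul_mem _
    (AddSubgroup.subset_closure (Set.mem_union_right _ ?_)) m)
    (AddSubgroup.subset_closure (Set.mem_union_right _ ?_))) h0
  · -- `[Ḡ, 1]`: `q = 1 − x²`, `α = 0/1`, `β = √q/(1 − x²)` over `{x² ≤ ¼}`
    exact ⟨-1, 0, 1, 0, 1, MvPolynomial.X 1, 1 - MvPolynomial.X 0 ^ 2, {x | x 0 ^ 2 ≤ 1 / 4},
      fun _ => 0, fun x => Real.sqrt (1 - x 0 ^ 2) / (1 - x 0 ^ 2), g,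
      isSemialgebraic_arcsinBase, conic_pos_of_mem_arcsinBase,
      fun x _ => by rw [map_one]; exact one_ne_zero,
      fun x hx => by
        have hx' : x 0 ^ 2 ≤ 1 / 4 := hx
        simp only [map_sub, map_one, map_pow, MvPolynomial.aeval_X, Matrix.cons_val_zero]
        exact (by linarith : (0 : ℝ) < 1 - x 0 ^ 2).ne',
      fun x _ => by simp, fun x _ => by rw [conic_eq]; simp,
      fun x hx => by
        have hx' : x 0 ^ 2 ≤ 1 / 4 := hx
        exact div_nonneg (Real.sqrt_nonneg _) (by linarith),
      hgd.trans arcsinBand_eq, hgi, rfl⟩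
  · -- `[D°, 1]`: `q = 1 − x²`, `α = −√q`, `β = √q` over `(−1, 1)`
    exact ⟨-1, 0, 1, -MvPolynomial.X 1, 1, MvPolynomial.X 1, 1, symIoo,
      fun x => -Real.sqrt (1 - x 0 ^ 2), fun x => Real.sqrt (1 - x 0 ^ 2),
      KZ.piRep.restrict discBand isSemialgebraic_discBand discBand_subset_piDisc,
      isSemialgebraic_symIoo, conic_pos_of_mem_symIoo,
      fun x _ => by rw [map_one]; exact one_ne_zero, fun x _ => by rw [map_one]; exact one_ne_zero,
      fun x _ => by rw [conic_eq]; simp, fun x _ => by rw [conic_eq]; simp,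
      fun x _ => neg_le_self (Real.sqrt_nonneg _), rfl, fun _ _ => rfl, rfl⟩

/-! ### Closing the band: `[G, g] ≡ [Ḡ, 1]` -/

/-- `|x| ≤ ½ ↔ x² ≤ ¼`. [folklore] -/
theorem abs_le_half_iff (x : ℝ) : |x| ≤ 1 / 2 ↔ x ^ 2 ≤ 1 / 4 := by
  rw [abs_le]
  constructor
  · rintro ⟨h1, h2⟩; nlinarith
  · intro h; constructor <;> nlinarith

/-- The inverted circle condition: for `t > 0`, `1 ≤ x² + (1/t)² ↔ t²(1 − x²) ≤ 1`. [folklore] -/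
theorem one_le_add_inv_sq_iff (x : ℝ) {t : ℝ} (ht : 0 < t) :
    1 ≤ x ^ 2 + t⁻¹ ^ 2 ↔ t ^ 2 * (1 - x ^ 2) ≤ 1 := by
  rw [inv_pow, ← one_div, ← sub_le_iff_le_add', le_div_iff₀ (pow_pos ht 2), mul_comm]

/-- **Closing the band.** The pull-back `[G, g]` of `[F₁, y⁻²]` along the inversion `t = 1/y`
(`G = {t > 0, (x, 1/t) ∈ F₁}`, `g(x, t) = (1/(1/t)²)/t² = 1`) differs from `[Ḡ, 1]` by relations:
`G ⊆ Ḡ` is co-null (`Ḡ ∖ G ⊆ {t = 0}`, rule (1)) and the integrands agree on `G`.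
[cite: KontsevichZagier2001, §1.2 rule (1)] -/
theorem of_sub_of_arcsinBandRep_mem {r r₁ g : KZ.IntegralRep 2}
    (hrd : r.domain = {x | |x 0| ≤ 1 / 2 ∧ 1 ≤ x 0 ^ 2 + x 1 ^ 2 ∧ 0 < x 1})
    (hri : Set.EqOn r.integrand (fun x => 1 / x 1 ^ 2) r.domain)
    (hr₁d : r₁.domain = {z | 0 < z 1 ∧ Function.update z 1 (z 1)⁻¹ ∈ r.domain})
    (hr₁i : Set.EqOn r₁.integrand
      (fun z => r.integrand (Function.update z 1 (z 1)⁻¹) / z 1 ^ 2) r₁.domain)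
    (hgd : g.domain = {z | z 0 ^ 2 ≤ 1 / 4 ∧ 0 ≤ z 1 ∧ z 1 ^ 2 * (1 - z 0 ^ 2) ≤ 1})
    (hgi : ∀ z ∈ g.domain, g.integrand z = 1) :
    KZ.of r₁ - KZ.of g ∈ KZ.relations := by
  have hmem : ∀ z : Fin 2 → ℝ,
      z ∈ r₁.domain ↔ 0 < z 1 ∧ z 0 ^ 2 ≤ 1 / 4 ∧ z 1 ^ 2 * (1 - z 0 ^ 2) ≤ 1 := by
    intro z
    rw [hr₁d, mem_setOf_eq, hrd, mem_setOf_eq, Function.update_self,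
      Function.update_of_ne Fin.zero_ne_one]
    refine and_congr_right fun hz => ?_
    rw [abs_le_half_iff, one_le_add_inv_sq_iff (z 0) hz, inv_pos, and_iff_left hz]
  have hsub : r₁.domain ⊆ g.domain := fun z hz => by
    obtain ⟨h1, h2, h3⟩ := (hmem z).1 hz
    rw [hgd]
    exact ⟨h2, h1.le, h3⟩
  have hnull : volume (g.domain \ r₁.domain) = 0 := by
    refine measure_mono_null (fun z hz => ?_) (KZ.volume_setOf_last_eq_zero (n := 1) 0)
    obtain ⟨hzg, h4⟩ := hz
    rw [hgd] at hzg
    obtain ⟨h1, h2, h3⟩ := hzg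
    rw [hmem] at h4
    show z 1 = 0
    by_contra h
    exact h4 ⟨lt_of_le_of_ne h2 (Ne.symm h), h1, h3⟩
  have hA : KZ.of g - KZ.of (g.restrict r₁.domain r₁.isSemialgebraic_domain hsub) ∈ KZ.relations :=
    KZ.IntegralRep.of_sub_of_restrict_mem_relations g r₁.isSemialgebraic_domain hsub hnull
  have hB : KZ.of (g.restrict r₁.domain r₁.isSemialgebraic_domain hsub) - KZ.of r₁ ∈
      KZ.relations := by
    refine KZ.of_sub_of_mem_relations_of_eqOn rfl fun z hz => ?_
    have hz' : z ∈ r₁.domain := hz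
    obtain ⟨h1, -, -⟩ := (hmem z).1 hz'
    have hu : Function.update z 1 (z 1)⁻¹ ∈ r.domain := by
      rw [hr₁d] at hz'
      exact hz'.2
    show g.integrand z = r₁.integrand z
    rw [hgi z (hsub hz')]
    simp only [hr₁i hz', hri hu, Function.update_self, one_div, inv_pow, inv_inv]
    rw [div_self (pow_ne_zero 2 h1.ne')]
  have : KZ.of r₁ - KZ.of g =
      -((KZ.of g - KZ.of (g.restrict r₁.domain r₁.isSemialgebraic_domain hsub)) +
        (KZ.of (g.restrict r₁.domain r₁.isSemialgebraic_domain hsub) - KZ.of r₁)) := by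
    abel
  rw [this]
  exact KZ.relations.neg_mem (KZ.relations.add_mem hA hB)

end SLTwoZ

/-- **THE COVOLUME OF THE MODULAR GROUP INSIDE THE RULES** (stub `stub_slTwoZCovolume` of line
`Sketch` for crux `TateLifting` = route EulerFormChain's `SLTwoZCovolume`, modulo the inversion engine
and the value of the arcsine band, taken as the two hypotheses): the standard fundamental domain
`F₁ = {|x| ≤ ½, x² + y² ≥ 1, y > 0}` of `SL₂(ℤ)` with the hyperbolic area form `dx dy/y²` is
KZ-equivalent to `[D̄, 1/3]` (`vol(ℍ/PSL₂(ℤ)) = π/3`): inversion move, a null segment, the conic-band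
kernel on `3 • [Ḡ, 1] − [D°, 1]`, `[D̄, 1] ≡ 3 • [D̄, 1/3]`, torsion-freeness of `FormalRep ⧸ relations`.
[cite: KontsevichZagier2001, §1.2] -/
theorem tateLifting_slTwoZCovolume :
    (∀ (n : ℕ) (r : KZ.IntegralRep (n + 1)), (∀ x ∈ r.domain, 0 < x (Fin.last n)) →
    ∃ r' : KZ.IntegralRep (n + 1),
      r'.domain = {z | 0 < z (Fin.last n) ∧ Function.update z (Fin.last n) (z (Fin.last n))⁻¹ ∈ r.domain} ∧
      Set.EqOn r'.integrand
        (fun z => r.integrand (Function.update z (Fin.last n) (z (Fin.last n))⁻¹) / z (Fin.last n) ^ 2) r'.domain ∧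
      KZ.of r - KZ.of r' ∈ KZ.relations) →
    (∀ (g : KZ.IntegralRep 2), g.domain = {z | z 0 ^ 2 ≤ 1 / 4 ∧ 0 ≤ z 1 ∧ z 1 ^ 2 * (1 - z 0 ^ 2) ≤ 1} →
      (∀ z ∈ g.domain, g.integrand z = 1) → g.value = Real.pi / 3) →
    ∀ (r r' : KZ.IntegralRep 2), r.domain = {x | |x 0| ≤ 1 / 2 ∧ 1 ≤ x 0 ^ 2 + x 1 ^ 2 ∧ 0 < x 1} →
      Set.EqOn r.integrand (fun x => 1 / x 1 ^ 2) r.domain → r'.domain = {x | x 0 ^ 2 + x 1 ^ 2 ≤ 1} →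
      Set.EqOn r'.integrand (fun _ => 1 / 3) r'.domain → KZ.Equivalent r r' := by
  intro hI hA r r' hrd hri hr'd hr'i
  -- (i) the inversion move `t = 1/y`
  obtain ⟨r₁, hr₁d, hr₁i, h1⟩ := hI 1 r fun x hx => by
    rw [hrd] at hx
    exact hx.2.2
  -- (ii) closing the band: `[G, g] ≡ [Ḡ, 1]`
  obtain ⟨g, hgd, hgi⟩ := SLTwoZ.exists_arcsinBandRep
  have h2 : KZ.of r₁ - KZ.of g ∈ KZ.relations :=
    SLTwoZ.of_sub_of_arcsinBandRep_mem hrd hri hr₁d hr₁i hgd hgi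
  -- (iii) `[D̄, 1] ≡ 3 • [D̄, 1/3]`
  have h3 : KZ.of KZ.piRep - (3 : ℤ) • KZ.of r' ∈ KZ.relations :=
    tateLifting_zsmulRep 2 3 r' KZ.piRep (by rw [hr'd]; rfl) fun x hx => by
      simp only [hr'i hx, KZ.piRep_integrand]
      norm_num
  -- (iv) the disc as a conic band `[D°, 1]`, up to the two points `(±1, 0)`
  have h4 := SLTwoZ.piRep_sub_discBandRep
  -- (v) the conic-band kernel on `3 • [Ḡ, 1] − [D°, 1]` (value `3 · π/3 − π = 0`)
  have h5 := SLTwoZ.zsmul_sub_discBandRep_mem_relations g hgd hgi 3 (by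
    rw [map_sub, map_zsmul, KZ.eval_of, KZ.eval_of, hA g hgd hgi, SLTwoZ.discBandRep_value,
      zsmul_eq_mul]
    push_cast
    ring)
  -- (vi) assemble and divide by `3`
  show KZ.of r - KZ.of r' ∈ KZ.relations
  refine (zsmul_mem_relations_iff (k := 3) (by norm_num) _).1 ?_
  have : (3 : ℤ) • (KZ.of r - KZ.of r') =
      (3 : ℤ) • (KZ.of r - KZ.of r₁) + (3 : ℤ) • (KZ.of r₁ - KZ.of g) +
      ((3 : ℤ) • KZ.of g -
        KZ.of (KZ.piRep.restrict discBand isSemialgebraic_discBand discBand_subset_piDisc)) -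
      (KZ.of KZ.piRep -
        KZ.of (KZ.piRep.restrict discBand isSemialgebraic_discBand discBand_subset_piDisc)) +
      (KZ.of KZ.piRep - (3 : ℤ) • KZ.of r') := by
    abel
  rw [this]
  exact KZ.relations.add_mem (KZ.relations.sub_mem (KZ.relations.add_mem (KZ.relations.add_mem
    (KZ.relations.zsmul_mem h1 3) (KZ.relations.zsmul_mem h2 3)) h5) h4) h3

end Summit.KontsevichZagierPeriods.InverseLandau

end
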